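import Summits.Ventures.AbcSig.Rows.XTemplateB
import Summits.Ventures.AbcSig.Rows.TemplateBC

/-!
# Venture AbcSig — EXTENDED ROW TEMPLATE for `xⁿ + 2^α yⁿ = C z²` (FAMILY C1b): per-orbit alternative with `ExcludesStd`

HONEST FRAMING. Fully PROVED template theorems of a COMPUTATION cell (`pub-abcsig`); CONDITIONAL on named hypotheses,
no claim on ABC or any summit. This file is the twin of `Rows/TemplateBC.lean` (branches `branchBC_v7`, `branchBC_iv3`)
in the pattern of `Rows/XTemplateC.lean` / `Rows/XTemplateAB.lean`: the per-orbit hypothesis is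
`o.Eliminated bs04Allowed n ∨ (M.Excludes N o fam ∨ M.ExcludesStd N o n)`, so that a row can discharge an orbit's residual
exponent IN THE KERNEL by a module certificate concluding `ExcludesStd` (M6 / M6χ Eisenstein congruences
`Recipes/EisPackage.lean`, `Recipes/EisChiPackage.lean`; charpoly norm-form kills `Sieve/CharpolySieve.lean`) or by a
Kraus-table exclusion (`Recipes/KrausDischarge.lean`, concluding `Excludes`), instead of taking a cited hypothesis. The
proofs are those of `TemplateBC` verbatim up to the final step `xno_solution_in_case` (`Rows/XTemplateB.lean`).

* `xbranchBC_v7` (`y` even, `α < n`, level `2C²`) and `xbranchBC_iv3` (`y` odd, `α = 3`, level `32C²`).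

Reference: [BS04] M. A. Bennett, C. M. Skinner, Canad. J. Math. 56 (2004) 23–54, §§2–4 and Thm. 1.2.
-/

namespace Summit.Ventures.AbcSig

/-- EXTENDED **Branch (v₇), `y` even** (`α < n`, `n ≥ 7`): level `2·C²`. For odd squarefree `C`, a prime `n ≥ 7` with
`n ∤ C`, and the cell's hypotheses at level `2C²` for the family "`(1, 2^α, C)`, exponent `n`, `y` even", there is no
primitive solution of `xⁿ + 2^α yⁿ = C z²` with `y` even and `xy ≠ ±1`. -/
theorem xbranchBC_v7 (α C : ℕ) (hsq : Squarefree C) (hCodd : Odd C) (M : NewformModel)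
    (hP : M.BS04Package) {orbs : List OrbitData} (hD : M.DataComplete (2 * C ^ 2) orbs)
    (n : ℕ) (hn : n.Prime) (h7 : 7 ≤ n) (hnC : ¬ n ∣ C) (hαn : α < n)
    (hS : ∀ o ∈ orbs, (∀ e ∈ o.coeffs, e.ell.Prime ∧ e.ell ≠ 2 ∧ ¬ e.ell ∣ 2 * C ^ 2) ∧
      (o.Eliminated bs04Allowed n ∨ (M.Excludes (2 * C ^ 2) o (famBC α C n (fun _ b => 2 ∣ b)) ∨
        M.ExcludesStd (2 * C ^ 2) o n)))
    (x y z : ℤ) (hy : 2 ∣ y) (h1 : x * y ≠ 1) (h2 : x * y ≠ -1) :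
    ¬ IsPrimitiveSolution 1 (2 ^ α) C n x y z := by
  intro hsol
  have hCpos : 0 < C := hCodd.pos
  have hCoddZ : ¬ 2 ∣ (C : ℤ) := by
    intro h
    have h' : (2 : ℕ) ∣ C := by exact_mod_cast h
    exact (Nat.not_even_iff_odd.mpr hCodd) (even_iff_two_dvd.mpr h')
  have hBb : 2 ∣ ((2 ^ α : ℕ) : ℤ) * y := Dvd.dvd.mul_left hy _
  have hCz := odd_Cc_of_two_dvd_Bb hsol hBb
  have hz : ¬ 2 ∣ z := fun h => hCz (Dvd.dvd.mul_left h _)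
  obtain ⟨z', hz'sgn, hz'⟩ := exists_sign_sub_four_dvd z C hz hCoddZ
  have hsol' : IsPrimitiveSolution 1 (2 ^ α) C n x y z' := hsol.of_sign hz'sgn
  have hv : (2 : ℤ) ^ 7 ∣ ((2 ^ α : ℕ) : ℤ) * y ^ n :=
    Dvd.dvd.mul_left ((pow_dvd_pow 2 h7).trans (pow_dvd_pow_of_dvd hy n)) _
  have hcase : FreyCase.Holds .v₇ 1 (2 ^ α) C n x y z' := ⟨hv, hz'⟩
  have hndvd : ¬ n ∣ 1 * 2 ^ α * C := by
    intro h
    rw [one_mul] at h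
    rcases (Nat.Prime.dvd_mul hn).mp h with h2 | hC
    · have := (Nat.prime_dvd_prime_iff_eq hn Nat.prime_two).mp (hn.dvd_of_dvd_pow h2)
      omega
    · exact hnC hC
  exact xno_solution_in_case M hP ⟨1, 2 ^ α, C, n, x, y, z'⟩ .v₇ (2 * C ^ 2) one_pos (by positivity) hCpos hsq hn h7
    hndvd (nthPowerFree_one_twoPow α n hαn (by omega)) hsol' h1 h2 hcase (bs04Level_one_twoPow α C n hsq hCodd hnC).1
    hD (famBC α C n (fun _ b => 2 ∣ b)) ⟨rfl, rfl, rfl, rfl, hy⟩ hS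

/-- EXTENDED **Branch (iv)₃, `y` odd, `α = 3`**: level `32·C²`. For odd squarefree `C`, a prime `n ≥ 7` with `n ∤ C`, and the
cell's hypotheses at level `32C²` for the family "`(1, 8, C)`, exponent `n`, `y` odd", there is no primitive solution of
`xⁿ + 8yⁿ = C z²` with `y` odd and `xy ≠ ±1`. -/
theorem xbranchBC_iv3 (C : ℕ) (hsq : Squarefree C) (hCodd : Odd C) (M : NewformModel)
    (hP : M.BS04Package) {orbs : List OrbitData} (hD : M.DataComplete (32 * C ^ 2) orbs)
    (n : ℕ) (hn : n.Prime) (h7 : 7 ≤ n) (hnC : ¬ n ∣ C)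
    (hS : ∀ o ∈ orbs, (∀ e ∈ o.coeffs, e.ell.Prime ∧ e.ell ≠ 2 ∧ ¬ e.ell ∣ 32 * C ^ 2) ∧
      (o.Eliminated bs04Allowed n ∨ (M.Excludes (32 * C ^ 2) o (famBC 3 C n (fun _ b => ¬ 2 ∣ b)) ∨
        M.ExcludesStd (32 * C ^ 2) o n)))
    (x y z : ℤ) (hy : ¬ 2 ∣ y) (h1 : x * y ≠ 1) (h2 : x * y ≠ -1) :
    ¬ IsPrimitiveSolution 1 (2 ^ 3) C n x y z := by
  intro hsol
  have hCpos : 0 < C := hCodd.pos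
  have hCoddZ : ¬ 2 ∣ (C : ℤ) := by
    intro h
    have h' : (2 : ℕ) ∣ C := by exact_mod_cast h
    exact (Nat.not_even_iff_odd.mpr hCodd) (even_iff_two_dvd.mpr h')
  have hBb : 2 ∣ ((2 ^ 3 : ℕ) : ℤ) * y := Dvd.dvd.mul_right (by norm_num) _
  have hCz := odd_Cc_of_two_dvd_Bb hsol hBb
  have hz : ¬ 2 ∣ z := fun h => hCz (Dvd.dvd.mul_left h _)
  have hx : ¬ 2 ∣ x := by
    have := odd_Aa_of_two_dvd_Bb hsol hBb
    simpa using this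
  have hxy : ¬ 2 ∣ x * y := by
    intro h
    rcases Int.prime_two.dvd_mul.mp h with h' | h'
    · exact hx h'
    · exact hy h'
  obtain ⟨z', hz'sgn, hz'⟩ := exists_sign_sub_four_dvd z C hz hCoddZ
  have hsol' : IsPrimitiveSolution 1 (2 ^ 3) C n x y z' := hsol.of_sign hz'sgn
  have hB3 : OrdTwoEq ((2 ^ 3 : ℕ) : ℤ) 3 := ⟨by norm_num, by norm_num⟩
  have hcase : FreyCase.Holds .iv₃ 1 (2 ^ 3) C n x y z' := ⟨hxy, hB3, hz'⟩
  have hndvd : ¬ n ∣ 1 * 2 ^ 3 * C := by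
    intro h
    rw [one_mul] at h
    rcases (Nat.Prime.dvd_mul hn).mp h with h2 | hC
    · have := (Nat.prime_dvd_prime_iff_eq hn Nat.prime_two).mp (hn.dvd_of_dvd_pow h2)
      omega
    · exact hnC hC
  exact xno_solution_in_case M hP ⟨1, 2 ^ 3, C, n, x, y, z'⟩ .iv₃ (32 * C ^ 2) one_pos (by positivity) hCpos hsq hn h7
    hndvd (nthPowerFree_one_twoPow 3 n (by omega) (by omega)) hsol' h1 h2 hcase
    (bs04Level_one_twoPow 3 C n hsq hCodd hnC).2 hD (famBC 3 C n (fun _ b => ¬ 2 ∣ b)) ⟨rfl, rfl, rfl, rfl, hy⟩ hS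

end Summit.Ventures.AbcSig
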